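import Literature.NumberTheory.DiophantineGeometry.AbcWave0QualityFormProofs
import HarnessLib

/-!
# The hard core is necessary: hard-core solutions are abc triples on four primes

Helper (`--supports`) for the line `matveev-face-clearing` of the crux
`Summit.ABC.ABC.Theses.RibetTakahashiSplit.FewPrimeValuationProduct` (stmt-ABC-1563): the
registered sub-goal `hardCore_of_freyFewPrime`.

The "Frey part" of the crux is the bound `∏_{ℓ ∣ abc} v_ℓ(abc) ≤ K_ε · rad(abc)^ε` on abc triples
`a + b = c` supported on `≤ 4` primes. A *hard-core solution* is a solution of
`±p^x ± q^y ± 2^k r^z = 0` in distinct odd primes `p, q, r` with `x, y, z, k ≥ 1`, i.e. one of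
`p^x + q^y = 2^k r^z`, `p^x + 2^k r^z = q^y`, `q^y + 2^k r^z = p^x`. Each such solution IS an abc
triple with `abc = 2^k p^x q^y r^z`, so that `(abc).primeFactors = {2, p, q, r}` (four primes),
`∏_{ℓ ∣ abc} v_ℓ(abc) = x·y·z·k` and `rad(abc) = 2pqr`. Hence the Frey part of the crux implies
the hard-core bound `x·y·z·k ≤ C_ε (2pqr)^ε`, with the same constant. Pure arithmetic:

* `hardCoreOfFrey_primeFactors_eq` — `(2^k p^x q^y r^z).primeFactors = {2, p, q, r}`;
* `hardCoreOfFrey_prod_factorization_eq` — `∏_ℓ v_ℓ(2^k p^x q^y r^z) = x·y·z·k`;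
* `hardCoreOfFrey_radical_eq` — `radical (2^k p^x q^y r^z) = 2pqr`;
* `hardCoreOfFrey_invariants` — the three invariants of the conclusion for any `a b c` with
  `abc = 2^k p^x q^y r^z`;
* `hardCore_of_freyFewPrime` — the registered sub-goal.
-/

-- `Summit.ABC.ABC` is the mandated summit-side namespace (CONVENTIONS §2); the duplicate is
-- deliberate.
set_option linter.dupNamespace false

noncomputable section

namespace Summit.ABC.ABC.Theorems.FewPrimeValuationProduct

open Finset
open Literature.NumberTheory.DiophantineGeometry

/-! ## Arithmetic of `2^k p^x q^y r^z` -/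

/-- The prime factors of `2^k p^x q^y r^z` (`p, q, r` primes, positive exponents) are
`{2, p, q, r}`. `[folklore]` -/
theorem hardCoreOfFrey_primeFactors_eq {p q r x y z k : ℕ} (hp : p.Prime) (hq : q.Prime)
    (hr : r.Prime) (hx : x ≠ 0) (hy : y ≠ 0) (hz : z ≠ 0) (hk : k ≠ 0) :
    (2 ^ k * p ^ x * q ^ y * r ^ z).primeFactors = {2, p, q, r} := by
  have h2 : 2 ^ k ≠ 0 := pow_ne_zero _ two_ne_zero
  have hp0 : p ^ x ≠ 0 := pow_ne_zero _ hp.ne_zero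
  have hq0 : q ^ y ≠ 0 := pow_ne_zero _ hq.ne_zero
  have hr0 : r ^ z ≠ 0 := pow_ne_zero _ hr.ne_zero
  rw [Nat.primeFactors_mul (mul_ne_zero (mul_ne_zero h2 hp0) hq0) hr0,
    Nat.primeFactors_mul (mul_ne_zero h2 hp0) hq0, Nat.primeFactors_mul h2 hp0,
    Nat.primeFactors_prime_pow hk Nat.prime_two, Nat.primeFactors_prime_pow hx hp,
    Nat.primeFactors_prime_pow hy hq, Nat.primeFactors_prime_pow hz hr]
  ext s
  simp only [Finset.mem_union, Finset.mem_singleton, Finset.mem_insert, or_assoc]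

/-- The valuation product of `n = 2^k p^x q^y r^z` (`p, q, r` distinct odd primes, positive
exponents) is `∏_{ℓ ∣ n} v_ℓ(n) = x·y·z·k`. `[folklore]` -/
theorem hardCoreOfFrey_prod_factorization_eq {p q r x y z k : ℕ} (hp : p.Prime) (hq : q.Prime)
    (hr : r.Prime) (hp2 : p ≠ 2) (hq2 : q ≠ 2) (hr2 : r ≠ 2) (hpq : p ≠ q) (hpr : p ≠ r)
    (hqr : q ≠ r) (hx : x ≠ 0) (hy : y ≠ 0) (hz : z ≠ 0) (hk : k ≠ 0) :
    ∏ ℓ ∈ (2 ^ k * p ^ x * q ^ y * r ^ z).primeFactors,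
        (2 ^ k * p ^ x * q ^ y * r ^ z).factorization ℓ = x * y * z * k := by
  have h2 : 2 ^ k ≠ 0 := pow_ne_zero _ two_ne_zero
  have hp0 : p ^ x ≠ 0 := pow_ne_zero _ hp.ne_zero
  have hq0 : q ^ y ≠ 0 := pow_ne_zero _ hq.ne_zero
  have hr0 : r ^ z ≠ 0 := pow_ne_zero _ hr.ne_zero
  rw [hardCoreOfFrey_primeFactors_eq hp hq hr hx hy hz hk, Finset.prod_insert, Finset.prod_insert,
    Finset.prod_pair hqr, Nat.factorization_mul (mul_ne_zero (mul_ne_zero h2 hp0) hq0) hr0,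
    Nat.factorization_mul (mul_ne_zero h2 hp0) hq0, Nat.factorization_mul h2 hp0,
    Nat.prime_two.factorization_pow, hp.factorization_pow, hq.factorization_pow,
    hr.factorization_pow]
  · simp only [Finsupp.coe_add, Pi.add_apply, Finsupp.single_eq_same,
      Finsupp.single_eq_of_ne hp2, Finsupp.single_eq_of_ne hq2, Finsupp.single_eq_of_ne hr2,
      Finsupp.single_eq_of_ne hp2.symm, Finsupp.single_eq_of_ne hpq.symm,
      Finsupp.single_eq_of_ne hpr.symm, Finsupp.single_eq_of_ne hq2.symm,
      Finsupp.single_eq_of_ne hpq, Finsupp.single_eq_of_ne hqr.symm,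
      Finsupp.single_eq_of_ne hr2.symm, Finsupp.single_eq_of_ne hpr,
      Finsupp.single_eq_of_ne hqr, add_zero, zero_add]
    ring
  all_goals simp only [Finset.mem_insert, Finset.mem_singleton]; omega

/-- The radical of `2^k p^x q^y r^z` (`p, q, r` distinct odd primes, positive exponents) is
`2pqr`. `[folklore]` -/
theorem hardCoreOfFrey_radical_eq {p q r x y z k : ℕ} (hp : p.Prime) (hq : q.Prime)
    (hr : r.Prime) (hp2 : p ≠ 2) (hq2 : q ≠ 2) (hr2 : r ≠ 2) (hpq : p ≠ q) (hpr : p ≠ r)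
    (hqr : q ≠ r) (hx : x ≠ 0) (hy : y ≠ 0) (hz : z ≠ 0) (hk : k ≠ 0) :
    UniqueFactorizationMonoid.radical (2 ^ k * p ^ x * q ^ y * r ^ z) = 2 * p * q * r := by
  rw [Nat.radical_eq_prod_primeFactors, hardCoreOfFrey_primeFactors_eq hp hq hr hx hy hz hk,
    Finset.prod_insert, Finset.prod_insert, Finset.prod_pair hqr]
  · ring
  all_goals simp only [Finset.mem_insert, Finset.mem_singleton]; omega

/-- For natural numbers `a b c` with `abc = 2^k p^x q^y r^z` (`p, q, r` distinct odd primes,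
positive exponents): `abc` has at most four prime factors, its valuation product is `x·y·z·k` and
`rad a b c = 2pqr`. `[folklore]` -/
theorem hardCoreOfFrey_invariants {p q r x y z k a b c : ℕ} (hp : p.Prime) (hq : q.Prime)
    (hr : r.Prime) (hp2 : p ≠ 2) (hq2 : q ≠ 2) (hr2 : r ≠ 2) (hpq : p ≠ q) (hpr : p ≠ r)
    (hqr : q ≠ r) (hx : x ≠ 0) (hy : y ≠ 0) (hz : z ≠ 0) (hk : k ≠ 0)
    (habc : a * b * c = 2 ^ k * p ^ x * q ^ y * r ^ z) :
    (a * b * c).primeFactors.card ≤ 4 ∧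
      ∏ ℓ ∈ (a * b * c).primeFactors, (a * b * c).factorization ℓ = x * y * z * k ∧
      Literature.NumberTheory.DiophantineGeometry.rad a b c = 2 * p * q * r := by
  refine ⟨?_, ?_, ?_⟩
  · rw [habc, hardCoreOfFrey_primeFactors_eq hp hq hr hx hy hz hk]
    exact Finset.card_le_four
  · rw [habc]
    exact hardCoreOfFrey_prod_factorization_eq hp hq hr hp2 hq2 hr2 hpq hpr hqr hx hy hz hk
  · rw [rad_def, habc]
    exact hardCoreOfFrey_radical_eq hp hq hr hp2 hq2 hr2 hpq hpr hqr hx hy hz hk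

/-! ## The registered sub-goal -/

/-- **The hard core is necessary.** The Frey part of the crux — the bound
`∏_{ℓ ∣ abc} v_ℓ(abc) ≤ K_ε · rad(abc)^ε` on abc triples supported on `≤ 4` primes — implies the
hard-core bound `x·y·z·k ≤ C_ε (2pqr)^ε` on the solutions of `±p^x ± q^y ± 2^k r^z = 0` in
distinct odd primes `p, q, r` with `x, y, z, k ≥ 1` (with `C_ε = K_ε`): each such solution is an
abc triple with `abc = 2^k p^x q^y r^z`, valuation product `x·y·z·k` and radical `2pqr`.
`[folklore]` -/
theorem hardCore_of_freyFewPrime :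
    (∀ ε : ℝ, 0 < ε → ∃ K : ℝ, ∀ a b c : ℕ,
      Literature.NumberTheory.DiophantineGeometry.IsABCTriple a b c →
      (a * b * c).primeFactors.card ≤ 4 →
      ((∏ p ∈ (a * b * c).primeFactors, (a * b * c).factorization p : ℕ) : ℝ) ≤
        K * (Literature.NumberTheory.DiophantineGeometry.rad a b c : ℝ) ^ ε) →
    ∀ ε : ℝ, 0 < ε → ∃ C : ℝ, ∀ p q r x y z k : ℕ, p.Prime → q.Prime → r.Prime →
      Odd p → Odd q → Odd r → p ≠ q → p ≠ r → q ≠ r → 0 < x → 0 < y → 0 < z → 0 < k →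
      (p ^ x + q ^ y = 2 ^ k * r ^ z ∨ p ^ x + 2 ^ k * r ^ z = q ^ y ∨
        q ^ y + 2 ^ k * r ^ z = p ^ x) →
      ((x * y * z * k : ℕ) : ℝ) ≤ C * ((2 * p * q * r : ℕ) : ℝ) ^ ε := by
  intro hfrey ε hε
  obtain ⟨K, hK⟩ := hfrey ε hε
  refine ⟨K, ?_⟩
  intro p q r x y z k hp hq hr hop hoq hor hpq hpr hqr hx hy hz hk hsol
  have hp2 : p ≠ 2 := by obtain ⟨m, hm⟩ := hop; omega
  have hq2 : q ≠ 2 := by obtain ⟨m, hm⟩ := hoq; omega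
  have hr2 : r ≠ 2 := by obtain ⟨m, hm⟩ := hor; omega
  -- Everything in the conclusion depends on the product `abc = 2^k p^x q^y r^z` only.
  have key : ∀ a b c : ℕ, IsABCTriple a b c → a * b * c = 2 ^ k * p ^ x * q ^ y * r ^ z →
      ((x * y * z * k : ℕ) : ℝ) ≤ K * ((2 * p * q * r : ℕ) : ℝ) ^ ε := by
    intro a b c habc hprod
    obtain ⟨hcard, hval, hrad⟩ :=
      hardCoreOfFrey_invariants hp hq hr hp2 hq2 hr2 hpq hpr hqr hx.ne' hy.ne' hz.ne' hk.ne' hprod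
    have h := hK a b c habc hcard
    rw [hval, hrad] at h
    exact h
  have hp2' : Nat.Coprime p 2 := (Nat.coprime_primes hp Nat.prime_two).mpr hp2
  have hq2' : Nat.Coprime q 2 := (Nat.coprime_primes hq Nat.prime_two).mpr hq2
  have hpq' : Nat.Coprime p q := (Nat.coprime_primes hp hq).mpr hpq
  have hpr' : Nat.Coprime p r := (Nat.coprime_primes hp hr).mpr hpr
  have hqr' : Nat.Coprime q r := (Nat.coprime_primes hq hr).mpr hqr
  have h2r : 0 < 2 ^ k * r ^ z := mul_pos (pow_pos two_pos k) (pow_pos hr.pos z)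
  rcases hsol with h | h | h
  · exact key (p ^ x) (q ^ y) (2 ^ k * r ^ z)
      ⟨pow_pos hp.pos x, pow_pos hq.pos y, h, Nat.Coprime.pow x y hpq'⟩ (by ring)
  · exact key (p ^ x) (2 ^ k * r ^ z) (q ^ y)
      ⟨pow_pos hp.pos x, h2r, h,
        Nat.Coprime.mul_right (Nat.Coprime.pow x k hp2') (Nat.Coprime.pow x z hpr')⟩ (by ring)
  · exact key (q ^ y) (2 ^ k * r ^ z) (p ^ x)
      ⟨pow_pos hq.pos y, h2r, h,
        Nat.Coprime.mul_right (Nat.Coprime.pow y k hq2') (Nat.Coprime.pow y z hqr')⟩ (by ring)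

end Summit.ABC.ABC.Theorems.FewPrimeValuationProduct

end
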